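import Mathlib
import Summits.QuantumFields.YangMills.Theorems.EguchiKawaiDirectionLadderSingleLinkReductionCore
import Literature.MeasureTheory.Group.HaarLocalChart
import HarnessLib

/-!
# Off-diagonal blocks of a Haar unitary: sorting the labels and allocating the budget

Combinatorial bookkeeping for the random-matrix input (RMT) of
`singleLinkRigidity_of_blocks_of_offDiagSmallBall` (stub B1 of crux `DirectionIncrement`, route
`EguchiKawaiDirectionLadder`): the Haar measure of `{W : offDiagBlockSq ℓ W ≤ N s}` for a block
labelling `ℓ : Fin N → Option (Fin m)`.

* Sorting: conjugating by a permutation matrix preserves the Haar measure and relabels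
  (`offDiagBlockSq_submatrix`, `labelPairCount_comp_perm`, `haar_offDiag_perm`), and every labelling is
  monotone after a permutation (`exists_perm_sorted`, `Tuple.sort` on `WithTop (Fin m)`).
* For a sorted labelling the sets `laterDiff ℓ k = {j > k : ℓ j ≠ ℓ k, both labelled}` are nested
  (`laterDiff_subset`), `∑_k |laterDiff k| = labelPairCount ℓ / 2` (`two_mul_sum_card_laterDiff`),
  and `∑_k ∑_{j ∈ laterDiff k} |W_{jk}|² ≤ offDiagBlockSq ℓ W` (`sum_laterDiff_le_offDiagBlockSq`).
* Dyadic budget allocation (`exists_alloc`): if `∑_k c_k ≤ N s` with `c_k ≥ 0` then some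
  `α : Fin N → Fin (L+1)` (`N < 2^L`) has `c_k ≤ s 2^{α_k}` for all `k` and `∑_k 2^{α_k} ≤ 3N`; there are
  at most `(L+1)^N` such `α`.

All [folklore].
-/

noncomputable section

open MeasureTheory Finset
open Literature.Barriers.QuantumFields
open Literature.MathematicalPhysics.QuantumFieldTheory (haarProbability)
open scoped ENNReal

namespace Summit.QuantumFields.YangMills.Theorems.EguchiKawaiDirectionLadder.HaarColumns

variable {N m : ℕ}

/-! ### Relabelling by a permutation -/

/-- `offDiagBlockSq` is invariant under a simultaneous permutation of rows, columns and labels.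
[folklore] -/
theorem offDiagBlockSq_submatrix (ℓ : Fin N → Option (Fin m)) (σ : Equiv.Perm (Fin N))
    (W : Matrix (Fin N) (Fin N) ℂ) :
    offDiagBlockSq (ℓ ∘ σ) (W.submatrix σ σ) = offDiagBlockSq ℓ W := by
  simp only [offDiagBlockSq, Function.comp_apply, Matrix.submatrix_apply]
  exact Fintype.sum_equiv σ _ _ fun j => Fintype.sum_equiv σ _ _ fun k => rfl

/-- `labelPairCount` is invariant under relabelling by a permutation. [folklore] -/
theorem labelPairCount_comp_perm (ℓ : Fin N → Option (Fin m)) (σ : Equiv.Perm (Fin N)) :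
    labelPairCount (ℓ ∘ σ) = labelPairCount ℓ := by
  unfold labelPairCount
  refine Finset.card_equiv (σ.prodCongr σ) fun p => ?_
  simp

/-- Conjugation by a permutation matrix permutes rows and columns:
`P_σ W P_σ⁻¹ = (W_{σ j, σ k})_{j,k}`. [folklore] -/
theorem coe_permUnitary_conj (σ : Equiv.Perm (Fin N)) (W : UN N) :
    ((permUnitary σ * W * (permUnitary σ)⁻¹ : UN N) : Matrix (Fin N) (Fin N) ℂ) =
      (W : Matrix (Fin N) (Fin N) ℂ).submatrix σ σ := by
  rw [Matrix.UnitaryGroup.mul_val, Matrix.UnitaryGroup.mul_val, Matrix.UnitaryGroup.inv_val]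
  change σ.permMatrix ℂ * (W : Matrix (Fin N) (Fin N) ℂ) * star (σ.permMatrix ℂ) = _
  rw [Matrix.star_eq_conjTranspose, Matrix.conjTranspose_permMatrix, Equiv.Perm.permMatrix,
    Equiv.Perm.permMatrix, PEquiv.toMatrix_toPEquiv_mul, PEquiv.mul_toMatrix_toPEquiv]
  ext j k
  simp [Equiv.Perm.inv_def]

/-- The event `{offDiagBlockSq ℓ W ≤ c}` is measurable (closed). [folklore] -/
theorem measurableSet_offDiagBlockSq_le (ℓ : Fin N → Option (Fin m)) (c : ℝ) :
    MeasurableSet {W : UN N | offDiagBlockSq ℓ (W : Matrix (Fin N) (Fin N) ℂ) ≤ c} := by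
  refine (isClosed_le ?_ continuous_const).measurableSet
  unfold offDiagBlockSq
  refine continuous_finsetSum _ fun j _ => continuous_finsetSum _ fun k _ => ?_
  split_ifs
  · exact ((continuous_apply_apply j k).comp continuous_subtype_val).norm.pow 2
  · exact continuous_const

/-- **Relabelling invariance of the off-diagonal-block event**: the Haar measure of
`{offDiagBlockSq ℓ W ≤ c}` equals that of `{offDiagBlockSq (ℓ ∘ σ) W ≤ c}` (conjugate by the permutation
matrix, which preserves the Haar measure). [folklore] -/
theorem haar_offDiag_perm (ℓ : Fin N → Option (Fin m)) (σ : Equiv.Perm (Fin N)) (c : ℝ) :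
    haarProbability (UN N) {W : UN N | offDiagBlockSq ℓ (W : Matrix (Fin N) (Fin N) ℂ) ≤ c} =
      haarProbability (UN N)
        {W : UN N | offDiagBlockSq (ℓ ∘ σ) (W : Matrix (Fin N) (Fin N) ℂ) ≤ c} := by
  set μ := haarProbability (UN N) with hμ
  haveI : μ.IsHaarMeasure := isHaarMeasure_haarProbability
  have hmp : MeasurePreserving (fun W : UN N => permUnitary σ * W * (permUnitary σ)⁻¹) μ μ :=
    Literature.MeasureTheory.Group.HaarLocalChart.measurePreserving_conj μ (permUnitary σ)
  have hset : {W : UN N | offDiagBlockSq ℓ (W : Matrix (Fin N) (Fin N) ℂ) ≤ c} =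
      (fun W : UN N => permUnitary σ * W * (permUnitary σ)⁻¹) ⁻¹'
        {W : UN N | offDiagBlockSq (ℓ ∘ σ) (W : Matrix (Fin N) (Fin N) ℂ) ≤ c} := by
    ext W
    simp only [Set.mem_setOf_eq, Set.mem_preimage, coe_permUnitary_conj, offDiagBlockSq_submatrix]
  rw [hset, hmp.measure_preimage (measurableSet_offDiagBlockSq_le _ c).nullMeasurableSet]

/-! ### Sorted labellings -/

/-- Every labelling becomes sorted (monotone as a map to `WithTop (Fin m)`, a free index `none`
being `⊤`) after a permutation of the indices (`Tuple.sort`). [folklore] -/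
theorem exists_perm_sorted (ℓ : Fin N → Option (Fin m)) :
    ∃ σ : Equiv.Perm (Fin N), Monotone (fun i => @id (WithTop (Fin m)) ((ℓ ∘ σ) i)) :=
  ⟨Tuple.sort (fun i => @id (WithTop (Fin m)) (ℓ i)), Tuple.monotone_sort (fun i => @id (WithTop (Fin m)) (ℓ i))⟩

/-- Membership in the costly set of column `k` (later indices carrying a different block label,
both labelled). [folklore] -/
theorem mem_laterDiff {ℓ : Fin N → Option (Fin m)} {k j : Fin N} :
    j ∈ (Finset.univ.filter fun j => k < j ∧ ℓ k ≠ ℓ j ∧ ℓ k ≠ none ∧ ℓ j ≠ none) ↔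
      k < j ∧ ℓ k ≠ ℓ j ∧ ℓ k ≠ none ∧ ℓ j ≠ none := by
  simp

/-- For a sorted labelling the costly sets are nested: `l ≤ k → laterDiff k ⊆ laterDiff l`.
[folklore] -/
theorem laterDiff_subset {ℓ : Fin N → Option (Fin m)} (hs : Monotone (fun i => @id (WithTop (Fin m)) (ℓ i))) {k l : Fin N}
    (hlk : l ≤ k) :
    (Finset.univ.filter fun j => k < j ∧ ℓ k ≠ ℓ j ∧ ℓ k ≠ none ∧ ℓ j ≠ none) ⊆
      (Finset.univ.filter fun j => l < j ∧ ℓ l ≠ ℓ j ∧ ℓ l ≠ none ∧ ℓ j ≠ none) := by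
  intro j hj
  rw [mem_laterDiff] at hj ⊢
  obtain ⟨hkj, hne, hk, hj⟩ := hj
  have h1 : @id (WithTop (Fin m)) (ℓ l) ≤ @id (WithTop (Fin m)) (ℓ k) := hs hlk
  have h2 : @id (WithTop (Fin m)) (ℓ k) ≤ @id (WithTop (Fin m)) (ℓ j) := hs hkj.le
  have h3 : @id (WithTop (Fin m)) (ℓ k) < @id (WithTop (Fin m)) (ℓ j) :=
    lt_of_le_of_ne h2 (fun h => hne h)
  have h4 : @id (WithTop (Fin m)) (ℓ l) < @id (WithTop (Fin m)) (ℓ j) := lt_of_le_of_lt h1 h3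
  have hktop : @id (WithTop (Fin m)) (ℓ k) ≠ ⊤ := fun h => hk h
  refine ⟨lt_of_le_of_lt hlk hkj, fun h => h4.ne (by simp only [id, h]), fun h => ?_, hj⟩
  have : @id (WithTop (Fin m)) (ℓ l) = ⊤ := h
  rw [this, top_le_iff] at h1
  exact hktop h1

/-- `laterDiff k ⊆ {j > k}`. [folklore] -/
theorem lt_of_mem_laterDiff {ℓ : Fin N → Option (Fin m)} {k j : Fin N}
    (h : j ∈ (Finset.univ.filter fun j => k < j ∧ ℓ k ≠ ℓ j ∧ ℓ k ≠ none ∧ ℓ j ≠ none)) :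
    k < j := (mem_laterDiff.1 h).1

/-- **The column sums are part of the off-diagonal-block mass**:
`∑_k ∑_{j ∈ laterDiff k} |W_{jk}|² ≤ offDiagBlockSq ℓ W`. [folklore] -/
theorem sum_laterDiff_le_offDiagBlockSq (ℓ : Fin N → Option (Fin m)) (W : Matrix (Fin N) (Fin N) ℂ) :
    ∑ k, ∑ j ∈ (Finset.univ.filter fun j => k < j ∧ ℓ k ≠ ℓ j ∧ ℓ k ≠ none ∧ ℓ j ≠ none),
      ‖W j k‖ ^ 2 ≤ offDiagBlockSq ℓ W := by
  unfold offDiagBlockSq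
  rw [Finset.sum_comm]
  refine Finset.sum_le_sum fun k _ => ?_
  set Lk := (Finset.univ.filter fun j => k < j ∧ ℓ k ≠ ℓ j ∧ ℓ k ≠ none ∧ ℓ j ≠ none) with hLk
  rw [← Finset.sum_filter_add_sum_filter_not Finset.univ (fun j => j ∈ Lk)]
  have h1 : ∑ j ∈ Finset.univ.filter (fun j => j ∈ Lk),
      (if ℓ j ≠ ℓ k ∧ ℓ j ≠ none ∧ ℓ k ≠ none then ‖W j k‖ ^ 2 else 0) =
      ∑ j ∈ Lk, ‖W j k‖ ^ 2 := by
    rw [Finset.filter_mem_eq_inter, Finset.univ_inter]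
    refine Finset.sum_congr rfl fun j hj => ?_
    obtain ⟨_, hne, hk, hj'⟩ := mem_laterDiff.1 hj
    rw [if_pos ⟨fun h => hne h.symm, hj', hk⟩]
  rw [h1]
  have h2 : 0 ≤ ∑ j ∈ Finset.univ.filter (fun j => ¬ j ∈ Lk),
      (if ℓ j ≠ ℓ k ∧ ℓ j ≠ none ∧ ℓ k ≠ none then ‖W j k‖ ^ 2 else 0) :=
    Finset.sum_nonneg fun j _ => by split_ifs <;> positivity
  linarith

/-- **Counting the labelled pairs**: `2 ∑_k |laterDiff k| = labelPairCount ℓ` (ordered pairs with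
different labels split into `k < j` and `k > j`). [folklore] -/
theorem two_mul_sum_card_laterDiff (ℓ : Fin N → Option (Fin m)) :
    2 * ∑ k, (Finset.univ.filter fun j => k < j ∧ ℓ k ≠ ℓ j ∧ ℓ k ≠ none ∧ ℓ j ≠ none).card =
      labelPairCount ℓ := by
  classical
  unfold labelPairCount
  set P : Fin N × Fin N → Prop := fun p => ℓ p.1 ≠ ℓ p.2 ∧ ℓ p.1 ≠ none ∧ ℓ p.2 ≠ none with hP
  set F := Finset.univ.filter P with hF
  set Flt := F.filter (fun p => p.1 < p.2) with hFlt
  set Fgt := F.filter (fun p => ¬ p.1 < p.2) with hFgt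
  have hsplit : F.card = Flt.card + Fgt.card := by
    rw [hFlt, hFgt]; exact (Finset.card_filter_add_card_filter_not _).symm
  -- `Flt` is the disjoint union over `k` of `{k} × laterDiff k`
  have hlt : Flt.card =
      ∑ k, (Finset.univ.filter fun j => k < j ∧ ℓ k ≠ ℓ j ∧ ℓ k ≠ none ∧ ℓ j ≠ none).card := by
    rw [hFlt, Finset.card_eq_sum_card_fiberwise (f := Prod.fst) (t := Finset.univ) (fun _ _ => mem_univ _)]
    refine Finset.sum_congr rfl fun k _ => ?_
    refine Finset.card_bij (fun p _ => p.2) ?_ ?_ ?_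
    · intro p hp
      simp only [Finset.mem_filter, Finset.mem_univ, true_and, hF] at hp
      obtain ⟨⟨hPp, h12⟩, rfl⟩ := hp
      exact mem_laterDiff.2 ⟨h12, hPp.1, hPp.2.1, hPp.2.2⟩
    · intro p hp q hq h
      simp only [Finset.mem_filter, hF] at hp hq
      exact Prod.ext (hp.2.trans hq.2.symm) h
    · intro j hj
      obtain ⟨hkj, hne, hk, hj'⟩ := mem_laterDiff.1 hj
      refine ⟨(k, j), ?_, rfl⟩
      simp [hF, hP, hkj, hne, hk, hj']
  -- swapping is a bijection `Flt ≃ Fgt`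
  have hgt : Fgt.card = Flt.card := by
    refine Finset.card_bij (fun p _ => p.swap) ?_ ?_ ?_
    · intro p hp
      simp only [Finset.mem_filter, Finset.mem_univ, true_and, hF, hFlt, hFgt, hP] at hp ⊢
      obtain ⟨⟨hne, h1, h2⟩, hnlt⟩ := hp
      refine ⟨⟨fun h => hne h.symm, h2, h1⟩, ?_⟩
      rcases lt_trichotomy p.1 p.2 with h | h | h
      · exact absurd h hnlt
      · exact absurd (congrArg ℓ h) hne
      · exact h
    · intro p _ q _ h
      exact Prod.swap_injective h
    · intro q hq
      simp only [Finset.mem_filter, Finset.mem_univ, true_and, hF, hFlt, hP] at hq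
      obtain ⟨⟨hne, h1, h2⟩, hlt'⟩ := hq
      refine ⟨q.swap, ?_, Prod.swap_swap q⟩
      simp only [Finset.mem_filter, Finset.mem_univ, true_and, hF, hFgt, hP, Prod.fst_swap,
        Prod.snd_swap]
      exact ⟨⟨fun h => hne h.symm, h2, h1⟩, fun h => lt_asymm hlt' h⟩
  rw [← hlt, hsplit, hgt]; ring

/-! ### Dyadic budget allocations -/

/-- There are at most `(L+1)^N` admissible dyadic allocations (`α : Fin N → Fin (L+1)` with
`∑_k 2^{α_k} ≤ 3N`). [folklore] -/
theorem card_allocSet_le (N L : ℕ) :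
    (Finset.univ.filter fun α : Fin N → Fin (L + 1) => ∑ k, 2 ^ (α k : ℕ) ≤ 3 * N).card ≤
      (L + 1) ^ N := by
  refine (Finset.card_filter_le _ _).trans ?_
  rw [Finset.card_univ, Fintype.card_fun, Fintype.card_fin, Fintype.card_fin]

/-- **Dyadic allocation**: if `c_k ≥ 0`, `∑_k c_k ≤ N s`, `s > 0` and `N < 2^L`, there is an admissible
allocation `α` with `c_k ≤ s 2^{α_k}` for all `k` (take the least level above `c_k`; minimality gives
`s 2^{α_k} ≤ 2 c_k + s`, whence `∑ 2^{α_k} ≤ 3N`). [folklore] -/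
theorem exists_alloc {L : ℕ} (hL : N < 2 ^ L) {s : ℝ} (hs : 0 < s) (c : Fin N → ℝ)
    (hc0 : ∀ k, 0 ≤ c k) (hsum : ∑ k, c k ≤ N * s) :
    ∃ α ∈ (Finset.univ.filter fun α : Fin N → Fin (L + 1) => ∑ k, 2 ^ (α k : ℕ) ≤ 3 * N),
      ∀ k, c k ≤ s * 2 ^ (α k : ℕ) := by
  classical
  have hck : ∀ k, c k ≤ s * 2 ^ L := by
    intro k
    have h1 : c k ≤ ∑ j, c j := Finset.single_le_sum (fun j _ => hc0 j) (Finset.mem_univ k)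
    have h2 : (N : ℝ) * s ≤ s * 2 ^ L := by
      rw [mul_comm]
      exact mul_le_mul_of_nonneg_left (by exact_mod_cast hL.le) hs.le
    linarith
  have hex : ∀ k, ∃ i, c k ≤ s * 2 ^ i := fun k => ⟨L, hck k⟩
  set a : Fin N → ℕ := fun k => Nat.find (hex k) with ha
  have haL : ∀ k, a k ≤ L := fun k => Nat.find_min' (hex k) (hck k)
  have haspec : ∀ k, c k ≤ s * 2 ^ (a k) := fun k => Nat.find_spec (hex k)
  have hamin : ∀ k, s * 2 ^ (a k) ≤ 2 * c k + s := by
    intro k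
    rcases Nat.eq_zero_or_pos (a k) with h0 | hpos
    · rw [h0, pow_zero, mul_one]; linarith [hc0 k]
    · obtain ⟨i, hi⟩ : ∃ i, a k = i + 1 := ⟨a k - 1, by omega⟩
      have hnot : ¬ c k ≤ s * 2 ^ i := by
        have hlt : i < Nat.find (hex k) := by
          have : a k = Nat.find (hex k) := rfl
          omega
        exact Nat.find_min (hex k) hlt
      rw [hi, pow_succ]
      push Not at hnot
      linarith
  refine ⟨fun k => ⟨a k, Nat.lt_succ_of_le (haL k)⟩, ?_, fun k => haspec k⟩
  rw [Finset.mem_filter]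
  refine ⟨Finset.mem_univ _, ?_⟩
  -- `s ∑ 2^{a k} ≤ 2 ∑ c_k + N s ≤ 3 N s`
  have h1 : s * ∑ k, (2 : ℝ) ^ (a k) ≤ 3 * N * s := by
    rw [Finset.mul_sum]
    calc ∑ k, s * (2 : ℝ) ^ (a k) ≤ ∑ k, (2 * c k + s) := Finset.sum_le_sum fun k _ => hamin k
      _ = 2 * ∑ k, c k + N * s := by
          rw [Finset.sum_add_distrib, Finset.mul_sum, Finset.sum_const, Finset.card_univ,
            Fintype.card_fin, nsmul_eq_mul]
      _ ≤ 2 * (N * s) + N * s := by linarith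
      _ = 3 * N * s := by ring
  have h2 : ∑ k, (2 : ℝ) ^ (a k) ≤ 3 * N := by
    rw [mul_comm] at h1
    have := le_of_mul_le_mul_right (by linarith : (∑ k, (2 : ℝ) ^ (a k)) * s ≤ 3 * N * s) hs
    linarith
  exact_mod_cast h2

end Summit.QuantumFields.YangMills.Theorems.EguchiKawaiDirectionLadder.HaarColumns

end
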